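import Literature.Analysis.FluidPDE.JiaSverak2014LocalisedData
import Literature.Analysis.FluidPDE.PressureEquationSlicing
import HarnessLib

/-!
# Jia–Šverák 2014, local higher regularity: the pressure on time slices

Analysis/FluidPDE proofs file (theorems only; no definitions, no named facts), part of the proof
of the named fact `Literature.Analysis.FluidPDE.jia_sverak_2014_local_higher_regularity`
(`JiaSverak2014LocalRegularity.lean`; H. Jia, V. Šverák, Invent. Math. 196 (2014) =
arXiv:1204.0529, §3 formula (3.3) and §4). The time derivative `∂ₜ∂ₓ^α u` is bounded through the
equation, which requires the pressure slice by slice: for a local Leray solution `(u, p)` on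
`(0,T') × ℝ³`, bounded by `K_b` on `(0,T_b') × B(x₀, 7/12)` and with uniformly local energy
`≤ α_u`, and the Kang–Miura–Tsai gauge `c(t) = c_{x₀,7/24}(t) ∈ L^{3/2}` of the pressure
expansion (3.3), for a.e. `τ < T_b'`: the gauged pressure `p(τ) - c(τ)` is integrable on
`B(x₀, 7/24)` with `∫_{B(x₀,7/24)} |p(τ) - c(τ)| ≤ Π(K_b, α_u)` (near field in `L²` by
Calderón–Zygmund, far field bounded by the uniformly local energy), and it solves the pressure
Poisson equation on the slice in the very weak sense, `∫ (p(τ) - c(τ)) Δψ = -∫ D²ψ(u(τ), u(τ))`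
for `ψ ∈ C_c^∞(B(x₀, 7/24))`.

* `pressure_slices` — the statement above.

## References

* H. Jia, V. Šverák, Invent. Math. 196 (2014) = arXiv:1204.0529, §3 (3.3), §4. Bib key
  `JiaSverak2014`.
* K. Kang, H. Miura, T.-P. Tsai, IMRN 2021 = arXiv:1812.10509, Lemma 3.4. Bib key
  `KangMiuraTsai2020`.
* G. Seregin, *Lecture notes on regularity theory for the Navier–Stokes equations* (2014), §6.3.
  Bib key `Seregin2014`.
-/

noncomputable section

open MeasureTheory TopologicalSpace Set Function Filter Metric
open _root_.Topology
open scoped ENNReal NNReal RealInnerProductSpace Laplacian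

namespace Literature.Analysis.FluidPDE

namespace JiaSverak2014

open Literature.Analysis.UnboundedOperators LemarieRieusset2016

set_option maxHeartbeats 4000000 in
/-- **The gauged pressure on time slices.** For `K_b ≥ 0` and `α_u` there is `Π ≥ 0` such that:
for every local Leray solution `(u,p)` on `(0,T') × ℝ³` (measurable datum), `0 < T_b' ≤ T'`, with
`|u| ≤ K_b` a.e. on `(0,T_b') × B(x₀,7/12)` and uniformly local energy `≤ α_u`, there is a gauge
`c ∈ L^{3/2}(0,T')` such that for a.e. `τ ∈ (0, T_b')`: `u(τ)` is measurable and bounded by `K_b`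
a.e. on `B(x₀,7/12)`; `p(τ) - c(τ)` is integrable on `B(x₀,7/24)` with
`∫_{B(x₀,7/24)} |p(τ) - c(τ)| ≤ Π`; and `∫ (p(τ) - c(τ)) Δψ = -∫ D²ψ(u(τ),u(τ))` for every test
function `ψ` on `B(x₀, 7/24)`.
[cite: JiaSverak2014, §3 (3.3)] [cite: KangMiuraTsai2020, Lemma 3.4] [cite: Seregin2014, §6.3] -/
theorem pressure_slices {Kb : ℝ} (hKb : 0 ≤ Kb) (αu : ℝ≥0) :
    ∃ Pp : ℝ, 0 ≤ Pp ∧ ∀ {T' : ℝ} {x₀ : EuclideanSpace ℝ (Fin 3)}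
      {u₀ : (EuclideanSpace ℝ (Fin 3)) → (EuclideanSpace ℝ (Fin 3))}
      {u : ℝ → (EuclideanSpace ℝ (Fin 3)) → (EuclideanSpace ℝ (Fin 3))} {p : ℝ → (EuclideanSpace ℝ (Fin 3)) → ℝ}
      {Tb' : ℝ},
      AEStronglyMeasurable u₀ volume → IsLocalLeraySolutionOn T' 1 u₀ u p → 0 < Tb' → Tb' ≤ T' →
      (∀ᵐ z ∂(volume.restrict (Ioo 0 Tb' ×ˢ ball x₀ (7 / 12))), ‖u z.1 z.2‖ ≤ Kb) →
      (∀ᵐ t ∂(volume.restrict (Ioo 0 T')), ∀ z : EuclideanSpace ℝ (Fin 3), ∫⁻ x in ball z 1, ‖u t x‖ₑ ^ 2 ≤ αu) →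
      ∃ cg : ℝ → ℝ, MemLp cg (3 / 2 : ℝ≥0∞) (volume.restrict (Ioo 0 T')) ∧
        ∀ᵐ τ ∂(volume.restrict (Ioo 0 Tb')),
          AEStronglyMeasurable (u τ) volume ∧
          (∀ᵐ x ∂(volume : Measure (EuclideanSpace ℝ (Fin 3))), x ∈ ball x₀ (7 / 12) → ‖u τ x‖ ≤ Kb) ∧
          IntegrableOn (fun x => p τ x - cg τ) (ball x₀ (7 / 24)) volume ∧
          (∫ x in ball x₀ (7 / 24), ‖p τ x - cg τ‖ ≤ Pp) ∧
          ∀ ψ : (EuclideanSpace ℝ (Fin 3)) → ℝ,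
            FunctionSpaces.IsTestFunctionOn (⟨ball x₀ (7 / 24), isOpen_ball⟩ : Opens (EuclideanSpace ℝ (Fin 3))) ψ →
            ∫ x, (p τ x - cg τ) * Δ ψ x = -∫ x, fderiv ℝ (fderiv ℝ ψ) x (u τ x) (u τ x) := by
  classical
  -- the Calderón–Zygmund constant at `q = 2` and the far-field constant
  obtain ⟨Cq, hCq⟩ := exists_eLpNorm_localPressureNear_le_of_bound (q := 2) (by norm_num) (by norm_num)
  obtain ⟨Ffar, hFfart, hFfar⟩ := exists_enorm_localPressureFar_le_of_uloc (r := (7 / 24 : ℝ)) (by norm_num) (by norm_num)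
  set Vq : ℝ≥0∞ := volume (ball (0 : EuclideanSpace ℝ (Fin 3)) (7 / 12)) with hVq
  have hVqt : Vq ≠ ⊤ := measure_ball_lt_top.ne
  set Vρ : ℝ≥0∞ := volume (ball (0 : EuclideanSpace ℝ (Fin 3)) (7 / 24)) with hVρ
  have hVρt : Vρ ≠ ⊤ := measure_ball_lt_top.ne
  set Pn : ℝ≥0∞ := (Cq : ℝ≥0∞) * (ENNReal.ofReal (Kb ^ 2) * Vq ^ (1 / (2 : ℝ≥0∞).toReal)) with hPn
  have hPnt : Pn ≠ ⊤ := by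
    simp only [hPn]
    exact ENNReal.mul_ne_top ENNReal.coe_ne_top (ENNReal.mul_ne_top ENNReal.ofReal_ne_top
      (ENNReal.rpow_ne_top_of_nonneg (by positivity) hVqt))
  have hFbt : Ffar * (αu : ℝ≥0∞) ≠ ⊤ := ENNReal.mul_ne_top hFfart ENNReal.coe_ne_top
  set PpE : ℝ≥0∞ := Pn * Vρ ^ (1 - 1 / (2 : ℝ≥0∞).toReal) + Ffar * (αu : ℝ≥0∞) * Vρ with hPpE
  have hPpEt : PpE ≠ ⊤ := by
    simp only [hPpE]
    exact ENNReal.add_ne_top.2 ⟨ENNReal.mul_ne_top hPnt (ENNReal.rpow_ne_top_of_nonneg (by norm_num) hVρt),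
      ENNReal.mul_ne_top hFbt hVρt⟩
  refine ⟨PpE.toReal, ENNReal.toReal_nonneg, ?_⟩
  intro T' x₀ u₀ u p Tb' hm₀ hu hTb' hTb'T' hbd hαu
  have hT' : 0 < T' := hTb'.trans_le hTb'T'
  set S' : Set (ℝ × EuclideanSpace ℝ (Fin 3)) := Ioo 0 T' ×ˢ (univ : Set (EuclideanSpace ℝ (Fin 3))) with hS'
  have hS'm : MeasurableSet S' := measurableSet_Ioo.prod MeasurableSet.univ
  /- ## the gauge -/
  obtain ⟨cg, hcg, hdec⟩ := hu.exists_pressure_decomposition x₀ (r := (7 / 24 : ℝ)) (by norm_num)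
  refine ⟨cg, hcg, ?_⟩
  have hu'' : IsLocalLeraySolutionOn Tb' 1 u₀ u p := hu.mono hTb'T'
  have hcT : MemLp cg (3 / 2 : ℝ≥0∞) (volume.restrict (Ioo 0 Tb')) :=
    hcg.mono_measure (Measure.restrict_mono (Ioo_subset_Ioo_right hTb'T') le_rfl)
  /- ## the distributional equations with gauged pressure on the cylinder -/
  have hslab : IsSuitableWeakSolutionOn (slab (EuclideanSpace ℝ (Fin 3)) (Ioo 0 Tb') isOpen_Ioo)
      1 0 u (fun s x => p s x - cg s) := hu''.suitable.sub_timeGauge_slab hcT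
  set Ω : Opens (EuclideanSpace ℝ (Fin 3)) := ⟨ball x₀ (7 / 24), isOpen_ball⟩ with hΩ
  have hns : IsDistributionalNSSolutionOn
      (⟨Ioo 0 Tb' ×ˢ (Ω : Set (EuclideanSpace ℝ (Fin 3))), isOpen_Ioo.prod Ω.isOpen⟩ : Opens (ℝ × EuclideanSpace ℝ (Fin 3)))
      1 0 u (fun s x => p s x - cg s) := by
    refine hslab.distributional.of_le ?_
    intro z hz
    exact mem_slab.2 hz.1
  have hf0 : LocallyIntegrableOn (uncurry (0 : ℝ → (EuclideanSpace ℝ (Fin 3)) → (EuclideanSpace ℝ (Fin 3))))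
      (Ioo 0 Tb' ×ˢ (Ω : Set (EuclideanSpace ℝ (Fin 3)))) volume :=
    (integrableOn_zero).locallyIntegrableOn
  have hdiv0 : ∀ φ : ℝ → (EuclideanSpace ℝ (Fin 3)) → ℝ,
      IsSpaceTimeTestOn (⟨Ioo 0 Tb' ×ˢ (Ω : Set (EuclideanSpace ℝ (Fin 3))), isOpen_Ioo.prod Ω.isOpen⟩ :
        Opens (ℝ × EuclideanSpace ℝ (Fin 3))) φ →
      ∫ z in Ioo 0 Tb' ×ˢ (Ω : Set (EuclideanSpace ℝ (Fin 3))),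
        ⟪(0 : ℝ → (EuclideanSpace ℝ (Fin 3)) → (EuclideanSpace ℝ (Fin 3))) z.1 z.2, gradient (φ z.1) z.2⟫ = 0 := by
    intro φ hφ
    simp only [Pi.zero_apply, inner_zero_left, integral_zero]
  have hpoisson := hns.ae_forall_slice_pressure_identity hf0 hdiv0
  /- ## slices of the velocity -/
  have hmeas : ∀ᵐ τ ∂(volume.restrict (Ioo 0 Tb')), AEStronglyMeasurable (u τ) volume :=
    ae_restrict_of_ae_restrict_of_subset (Ioo_subset_Ioo_right hTb'T') hu.ae_aestronglyMeasurable_slice'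
  have hbdτ : ∀ᵐ τ ∂(volume.restrict (Ioo 0 Tb')), ∀ᵐ x ∂(volume : Measure (EuclideanSpace ℝ (Fin 3))),
      x ∈ ball x₀ (7 / 12) → ‖u τ x‖ ≤ Kb := by
    have h := SerrinBoundedHolder.ae_ae_of_ae_restrict_prod hbd
    filter_upwards [h] with t ht
    exact (ae_restrict_iff' measurableSet_ball).1 ht
  have hαuτ : ∀ᵐ τ ∂(volume.restrict (Ioo 0 Tb')), ∀ z : EuclideanSpace ℝ (Fin 3), ∫⁻ x in ball z 1, ‖u τ x‖ₑ ^ 2 ≤ αu :=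
    ae_restrict_of_ae_restrict_of_subset (Ioo_subset_Ioo_right hTb'T') hαu
  /- ## integrability of the gauged pressure on slices -/
  have hptK : IntegrableOn (fun z : ℝ × EuclideanSpace ℝ (Fin 3) => p z.1 z.2 - cg z.1)
      (Ioo 0 Tb' ×ˢ closedBall x₀ (7 / 24)) volume := by
    have hK : IsCompact (closedBall x₀ (7 / 24 : ℝ)) := isCompact_closedBall _ _
    haveI : IsFiniteMeasure ((volume : Measure (ℝ × (EuclideanSpace ℝ (Fin 3)))).restrict (Ioo 0 Tb' ×ˢ closedBall x₀ (7 / 24))) :=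
      ⟨by rw [Measure.restrict_apply_univ]; exact volume_Ioo_prod_lt_top hK⟩
    have hsub : Ioo 0 Tb' ×ˢ closedBall x₀ (7 / 24) ⊆ ((slab (EuclideanSpace ℝ (Fin 3)) (Ioo 0 Tb') isOpen_Ioo :
        Opens (ℝ × (EuclideanSpace ℝ (Fin 3)))) : Set (ℝ × (EuclideanSpace ℝ (Fin 3)))) :=
      fun z hz => mem_slab.2 hz.1
    have hp1 : IntegrableOn (uncurry p) (Ioo 0 Tb' ×ˢ closedBall x₀ (7 / 24)) volume := by
      have hm : AEStronglyMeasurable (uncurry p)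
          ((volume : Measure (ℝ × (EuclideanSpace ℝ (Fin 3)))).restrict (Ioo 0 Tb' ×ˢ closedBall x₀ (7 / 24))) :=
        (hu''.suitable.distributional.2.2.1.mono_set hsub).aestronglyMeasurable
      exact BradshawTsai2019.integrable_of_lintegral_rpow_enorm_lt_top hm (by norm_num : (1 : ℝ) ≤ 3 / 2)
        (hu''.pressure _ hK)
    have hc1 : IntegrableOn (fun z : ℝ × (EuclideanSpace ℝ (Fin 3)) => cg z.1) (Ioo 0 Tb' ×ˢ closedBall x₀ (7 / 24)) volume := by
      haveI : IsFiniteMeasure ((volume : Measure ℝ).restrict (Ioo 0 Tb')) := ⟨by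
        rw [Measure.restrict_apply_univ]; exact measure_Ioo_lt_top⟩
      have h32 : (1 : ℝ≥0∞) ≤ 3 / 2 :=
        ((ENNReal.lt_div_iff_mul_lt (Or.inl two_ne_zero) (Or.inl ENNReal.ofNat_ne_top)).2 (by norm_num)).le
      have hci : Integrable cg ((volume : Measure ℝ).restrict (Ioo 0 Tb')) := hcT.integrable h32
      haveI : IsFiniteMeasure ((volume : Measure (EuclideanSpace ℝ (Fin 3))).restrict (closedBall x₀ (7 / 24))) :=
        ⟨by rw [Measure.restrict_apply_univ]; exact hK.measure_lt_top⟩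
      have h1 : Integrable (fun _ : EuclideanSpace ℝ (Fin 3) => (1 : ℝ))
          ((volume : Measure (EuclideanSpace ℝ (Fin 3))).restrict (closedBall x₀ (7 / 24))) := integrable_const _
      have h := hci.mul_prod h1
      rw [IntegrableOn, Measure.volume_eq_prod, ← Measure.prod_restrict]
      simpa using h
    exact hp1.sub hc1
  have hintτ : ∀ᵐ τ ∂(volume.restrict (Ioo 0 Tb')), IntegrableOn (fun x => p τ x - cg τ) (ball x₀ (7 / 24)) volume := by
    have h := hptK
    rw [IntegrableOn, Measure.volume_eq_prod, ← Measure.prod_restrict] at h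
    filter_upwards [h.prod_right_ae] with τ hτ
    exact (show IntegrableOn (fun x => p τ x - cg τ) (closedBall x₀ (7 / 24)) volume from hτ).mono_set ball_subset_closedBall
  /- ## measurable versions of the pressure pieces and their sizes -/
  have hNae := hu.aestronglyMeasurable_localPressureNear x₀ (7 / 24 : ℝ)
  have hFae := hu.aestronglyMeasurable_localPressureFar x₀ (7 / 24 : ℝ)
  rw [← volume_restrict_slab_eq] at hNae hFae
  set nearM : ℝ × EuclideanSpace ℝ (Fin 3) → ℝ := hNae.mk _ with hnearM
  set farM : ℝ × EuclideanSpace ℝ (Fin 3) → ℝ := hFae.mk _ with hfarM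
  have hnearMm : Measurable nearM := hNae.stronglyMeasurable_mk.measurable
  have hfarMm : Measurable farM := hFae.stronglyMeasurable_mk.measurable
  have hnearae : ∀ᵐ z ∂(volume : Measure (ℝ × EuclideanSpace ℝ (Fin 3))), z ∈ S' →
      localPressureNear x₀ (7 / 24) u z.1 z.2 = nearM z := (ae_restrict_iff' hS'm).1 hNae.ae_eq_mk
  have hfarae : ∀ᵐ z ∂(volume : Measure (ℝ × EuclideanSpace ℝ (Fin 3))), z ∈ S' →
      localPressureFar x₀ (7 / 24) u z.1 z.2 = farM z := (ae_restrict_iff' hS'm).1 hFae.ae_eq_mk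
  -- slice-wise versions
  have hq : Measure.QuasiMeasurePreserving (Prod.fst : ℝ × EuclideanSpace ℝ (Fin 3) → ℝ) volume volume := by
    rw [Measure.volume_eq_prod]; exact Measure.quasiMeasurePreserving_fst
  have hnear_sl : ∀ᵐ t ∂(volume.restrict (Ioo 0 Tb')), ∀ᵐ x ∂(volume : Measure (EuclideanSpace ℝ (Fin 3))),
      localPressureNear x₀ (7 / 24) u t x = nearM (t, x) := by
    have h := (ae_restrict_iff' hS'm).2 hnearae
    have h' := SerrinBoundedHolder.ae_ae_of_ae_restrict_prod (I := Ioo 0 T') (B := (univ : Set (EuclideanSpace ℝ (Fin 3))))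
      (P := fun z => localPressureNear x₀ (7 / 24) u z.1 z.2 = nearM z) (h.mono fun z hz => hz)
    simp only [Measure.restrict_univ] at h'
    exact ae_restrict_of_ae_restrict_of_subset (Ioo_subset_Ioo_right hTb'T') h'
  have hfar_sl : ∀ᵐ t ∂(volume.restrict (Ioo 0 Tb')), ∀ᵐ x ∂(volume : Measure (EuclideanSpace ℝ (Fin 3))),
      localPressureFar x₀ (7 / 24) u t x = farM (t, x) := by
    have h := (ae_restrict_iff' hS'm).2 hfarae
    have h' := SerrinBoundedHolder.ae_ae_of_ae_restrict_prod (I := Ioo 0 T') (B := (univ : Set (EuclideanSpace ℝ (Fin 3))))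
      (P := fun z => localPressureFar x₀ (7 / 24) u z.1 z.2 = farM z) (h.mono fun z hz => hz)
    simp only [Measure.restrict_univ] at h'
    exact ae_restrict_of_ae_restrict_of_subset (Ioo_subset_Ioo_right hTb'T') h'
  have hdec_sl : ∀ᵐ t ∂(volume.restrict (Ioo 0 Tb')), ∀ᵐ x ∂(volume.restrict (ball x₀ (7 / 24))),
      p t x = localPressureNear x₀ (7 / 24) u t x + localPressureFar x₀ (7 / 24) u t x + cg t :=
    ae_restrict_of_ae_restrict_of_subset (Ioo_subset_Ioo_right hTb'T') (SerrinBoundedHolder.ae_ae_of_ae_restrict_prod hdec)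
  -- near field: slice bound in `L²`
  have hnear_slice : ∀ᵐ t ∂(volume.restrict (Ioo 0 Tb')), eLpNorm (fun x => nearM (t, x)) 2 volume ≤ Pn := by
    filter_upwards [hnear_sl, hmeas, hbdτ] with t ht1 ht2 ht3
    have hb' : ∀ᵐ x ∂(volume : Measure (EuclideanSpace ℝ (Fin 3))), x ∈ ball x₀ (2 * (7 / 24)) → ‖u t x‖ ≤ Kb := by
      rw [show (2 : ℝ) * (7 / 24) = 7 / 12 by norm_num]; exact ht3
    have h := hCq hKb ht2 hb'
    rw [show (2 : ℝ) * (7 / 24) = 7 / 12 by norm_num, Measure.addHaar_ball_center] at h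
    calc eLpNorm (fun x => nearM (t, x)) 2 volume = eLpNorm (localPressureNear x₀ (7 / 24) u t) 2 volume :=
          (eLpNorm_congr_ae (ht1.mono fun x hx => hx.symm))
      _ ≤ _ := h
  -- far field: pointwise bound on slices
  have hfar_slice : ∀ᵐ t ∂(volume.restrict (Ioo 0 Tb')), ∀ᵐ x ∂(volume : Measure (EuclideanSpace ℝ (Fin 3))),
      x ∈ ball x₀ (7 / 24) → ‖farM (t, x)‖ₑ ≤ Ffar * (αu : ℝ≥0∞) := by
    filter_upwards [hfar_sl, hmeas, hαuτ] with t ht1 ht2 ht3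
    filter_upwards [ht1] with x hx hxB
    rw [← hx]
    exact hFfar ht2 ht3 x hxB
  /- ## assembly -/
  filter_upwards [hpoisson, hmeas, hbdτ, hintτ, hnear_sl, hfar_sl, hdec_sl, hnear_slice, hfar_slice]
    with τ hP hm hb hint hn hf hd hns2 hfs
  have hloc2 : LocallyIntegrableOn (fun x => ‖u τ x‖ ^ 2) (Ω : Set (EuclideanSpace ℝ (Fin 3))) volume := by
    haveI : IsFiniteMeasure ((volume : Measure (EuclideanSpace ℝ (Fin 3))).restrict (ball x₀ (7 / 24))) :=
      ⟨by rw [Measure.restrict_apply_univ]; exact measure_ball_lt_top⟩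
    have hi : IntegrableOn (fun x => ‖u τ x‖ ^ 2) (ball x₀ (7 / 24)) volume := by
      refine Integrable.mono' (integrable_const (Kb ^ 2)) ((hm.norm.pow 2).restrict) ?_
      rw [ae_restrict_iff' measurableSet_ball]
      filter_upwards [hb] with x hx hxB
      have hxB' : x ∈ ball x₀ (7 / 12) := ball_subset_ball (by norm_num) hxB
      rw [Real.norm_eq_abs, abs_pow, abs_norm]
      exact pow_le_pow_left₀ (norm_nonneg _) (hx hxB') 2
    exact hi.locallyIntegrableOn
  have hlocp : LocallyIntegrableOn (fun x => p τ x - cg τ) (Ω : Set (EuclideanSpace ℝ (Fin 3))) volume :=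
    hint.locallyIntegrableOn
  refine ⟨hm, hb, hint, ?_, fun ψ hψ => ?_⟩
  · -- the `L¹` bound on the slice
    have hL : ∫⁻ x in ball x₀ (7 / 24), ‖p τ x - cg τ‖ₑ ≤ PpE := by
      have hpt' : ∀ᵐ x ∂(volume.restrict (ball x₀ (7 / 24))),
          ‖p τ x - cg τ‖ₑ ≤ ‖nearM (τ, x)‖ₑ + Ffar * (αu : ℝ≥0∞) := by
        rw [ae_restrict_iff' measurableSet_ball] at hd ⊢
        filter_upwards [hd, hn, hf, hfs] with x hx hxn hxf hxfs hxB
        have e : p τ x - cg τ = nearM (τ, x) + farM (τ, x) := by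
          rw [hx hxB, hxn, hxf]; ring
        rw [e]
        exact (enorm_add_le _ _).trans (add_le_add le_rfl (hxfs hxB))
      calc ∫⁻ x in ball x₀ (7 / 24), ‖p τ x - cg τ‖ₑ
          ≤ ∫⁻ x in ball x₀ (7 / 24), (‖nearM (τ, x)‖ₑ + Ffar * (αu : ℝ≥0∞)) := lintegral_mono_ae hpt'
        _ = (∫⁻ x in ball x₀ (7 / 24), ‖nearM (τ, x)‖ₑ) + Ffar * (αu : ℝ≥0∞) * volume (ball x₀ (7 / 24 : ℝ)) := by
            have hmn : Measurable fun x : EuclideanSpace ℝ (Fin 3) => ‖nearM (τ, x)‖ₑ :=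
              (hnearMm.comp measurable_prodMk_left).enorm
            rw [lintegral_add_left hmn, lintegral_const, Measure.restrict_apply_univ]
        _ ≤ Pn * Vρ ^ (1 - 1 / (2 : ℝ≥0∞).toReal) + Ffar * (αu : ℝ≥0∞) * Vρ := by
            refine add_le_add ?_ ?_
            · have hmt : AEStronglyMeasurable (fun x => nearM (τ, x)) (volume : Measure (EuclideanSpace ℝ (Fin 3))) :=
                (hnearMm.comp measurable_prodMk_left).aestronglyMeasurable
              have h := setLIntegral_enorm_le_eLpNorm_mul_measure_rpow (μ := (volume : Measure (EuclideanSpace ℝ (Fin 3))))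
                hmt (q := 2) (by norm_num) (ball x₀ (7 / 24))
              have hV : (volume : Measure (EuclideanSpace ℝ (Fin 3))) (ball x₀ (7 / 24)) = Vρ := by
                rw [hVρ, Measure.addHaar_ball_center]
              rw [hV] at h
              exact h.trans (mul_le_mul' hns2 le_rfl)
            · rw [Measure.addHaar_ball_center]
    rw [integral_norm_eq_lintegral_enorm hint.aestronglyMeasurable]
    exact ENNReal.toReal_mono hPpEt hL
  · have h := hP hm.restrict hloc2 hlocp ψ hψ
    linarith

end JiaSverak2014

end Literature.Analysis.FluidPDE
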